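import Literature.Probability.Percolation.DiagonalBoxCrossing
import Literature.Probability.Percolation.InequalitiesProofs
import Literature.Probability.Percolation.LatticeSymmetry
import Literature.Probability.Percolation.RSW
import HarnessLib

/-!
# Stub `stub_armLePassage` of line `ip-passage-stirling`
(crux `CardyBoundaryCoulombGas.HalfPlaneOneArmThird`, stmt-CriticalPhenomena-5662)

`c · π◇(n) ≤ P_b(2n+1)` (`n ≥ 1`, absolute `c > 0`) for bond percolation on `ℤ²` at `p = 1/2`;
`s = v₀ + v₁ = hgtOf v`, `d = v₀ - v₁ = col v`, `π◇(n) = P[0 ↔ {s = -n} ∪ {d = ±n} inside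
{-n ≤ s ≤ 1, |d| ≤ n}]`, `P_b(2n+1) = P[(2n,0) ↔ {s = 0} inside {0 ≤ s ≤ 2n+1}]` (Ikhlef–Ponsaing).
Proof (Grimmett 1999 §11.7; Grimmett–Manolescu 2014 §2.3). By translation
(`real_openCrossing_shift`) `P_b(2n+1) = P[0 ↔ {s = -2n} inside T]`, `T = {-2n ≤ s ≤ 1}`. Four
turned boxes of the straight drawing `zDia` (`diag_lr_lower`, `diag_tb_lower`: probability `≥ c₀`
from a scale `m₀` on, uniformly in the position) — bar `C_h[{|d| ≤ n} × {-n ≤ s ≤ 0}]`, pillars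
`C_v[{0 ≤ d ≤ n} × {1-2n ≤ s ≤ 1}]`, `C_v[{-n ≤ d ≤ 0} × {1-2n ≤ s ≤ 1}]`, down-crossing
`C_v[{0 ≤ d ≤ n} × {-2n ≤ s ≤ 0}]` — glue with the arm into `0 ↔ {s = -2n}` inside `T` (`arm_glue`;
crossing lattice paths of the isoradial drawing `zDia = G_{0,π/2}` share a vertex,
`exists_common_vertex_of_openCrossing`); Harris–FKG (`harris_fkg_holds`) gives
`c_V³ c_H · π◇(n) ≤ P_b(2n+1)` for `n ≥ m₀` (`passage_ge_of_scale`); below `m₀` the open axis row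
gives `P_b(2n+1) ≥ 4⁻ⁿ` (`pow_le_passage`).
-/

noncomputable section

namespace Summit.CriticalPhenomena.CardyFormulaZ2.Cruxes.HalfPlaneOneArmThird.IpPassageStirling

open MeasureTheory Literature.Probability.Percolation Literature.Probability.LatticeModels
open Complex Literature.Probability.Percolation.TrackExchange

/-- Real part of the straight drawing `G_{0,π/2} = zDia`: the diamond column `d = v₀ - v₁`. -/
private theorem dia_re (v : Site 2) :
    ((gmEmbedding (fun _ => (0 : ℝ)) (fun _ => Real.pi / 2)).z v).re = col v := by
  rw [zDia_eq_gmEmbedding_z, zDia_re]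

/-- Imaginary part of the straight drawing `G_{0,π/2} = zDia`: the diamond height `s = v₀ + v₁`. -/
private theorem dia_im (v : Site 2) :
    ((gmEmbedding (fun _ => (0 : ℝ)) (fun _ => Real.pi / 2)).z v).im = hgtOf v := by
  rw [zDia_eq_gmEmbedding_z, zDia_im]

/-- **Crossing lattice paths meet** (`exists_common_vertex_of_openCrossing` for the drawing `zDia`,
in lattice coordinates): an open path inside `S ⊆ {c₁ ≤ s ≤ c₂}` from `{d ≤ a₁}` to `{a₂ ≤ d}` and
an open path inside `S' ⊆ {a₁ ≤ d ≤ a₂}` from `{s ≤ c₁}` to `{c₂ ≤ s}` pass through a common vertex,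
joined inside `S` to both ends of the first and inside `S'` to both ends of the second. -/
private theorem meet {ω : BondConfig (Site 2)} (hω : ω ⊆ (zdGraph 2).edgeSet)
    {S S' : Set (Site 2)} {x y x' y' : Site 2} (h₁ : ω ∈ openConnIn S x y)
    (h₂ : ω ∈ openConnIn S' x' y') {a₁ a₂ c₁ c₂ : ℤ} (ha : a₁ < a₂) (hc : c₁ < c₂)
    (hS : ∀ v ∈ S, c₁ ≤ hgtOf v ∧ hgtOf v ≤ c₂) (hx : col x ≤ a₁) (hy : a₂ ≤ col y)
    (hS' : ∀ v ∈ S', a₁ ≤ col v ∧ col v ≤ a₂) (hx' : hgtOf x' ≤ c₁) (hy' : c₂ ≤ hgtOf y') :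
    ∃ v, ω ∈ openConnIn S x v ∧ ω ∈ openConnIn S v y ∧
      ω ∈ openConnIn S' x' v ∧ ω ∈ openConnIn S' v y' := by
  have gl := exists_common_vertex_of_openCrossing
    (emb := gmEmbedding (fun _ => (0 : ℝ)) (fun _ => Real.pi / 2))
    isIsoradial_dia isRhombicTiling_dia hω (S := S) (A := {x}) (B := {y}) (S' := S') (A' := {x'})
    (B' := {y'}) (a₁ := (a₁ : ℝ)) (a₂ := (a₂ : ℝ)) (c₁ := (c₁ : ℝ)) (c₂ := (c₂ : ℝ))
    (by exact_mod_cast ha) (by exact_mod_cast hc)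
    (fun v hv => by
      rw [dia_im]; exact ⟨by exact_mod_cast (hS v hv).1, by exact_mod_cast (hS v hv).2⟩)
    (fun v hv => by rw [Set.mem_singleton_iff.1 hv, dia_re]; exact_mod_cast hx)
    (fun v hv => by rw [Set.mem_singleton_iff.1 hv, dia_re]; exact_mod_cast hy)
    (fun v hv => by
      rw [dia_re]; exact ⟨by exact_mod_cast (hS' v hv).1, by exact_mod_cast (hS' v hv).2⟩)
    (fun v hv => by rw [Set.mem_singleton_iff.1 hv, dia_im]; exact_mod_cast hx')
    (fun v hv => by rw [Set.mem_singleton_iff.1 hv, dia_im]; exact_mod_cast hy')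
    ⟨x, rfl, y, rfl, h₁⟩ ⟨x', rfl, y', rfl, h₂⟩
  obtain ⟨v, -, -, ⟨x₁, hx₁, hxv⟩, ⟨y₁, hy₁, hvy⟩, ⟨x₂, hx₂, hx'v⟩, ⟨y₂, hy₂, hvy'⟩⟩ := gl
  exact ⟨v, (Set.mem_singleton_iff.1 hx₁) ▸ hxv, (Set.mem_singleton_iff.1 hy₁) ▸ hvy,
    (Set.mem_singleton_iff.1 hx₂) ▸ hx'v, (Set.mem_singleton_iff.1 hy₂) ▸ hvy'⟩

/-- A left–right crossing of the turned `2m × m` box at `(A, B)` (the event of `diag_lr_lower`,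
slack `±2` in `d`) contains, on a lattice configuration, an open path inside the exact box
`{A ≤ d ≤ A + 2m, B ≤ s ≤ B + m}` from `{d = A}` to `{d = A + 2m}` (`col` is `1`-Lipschitz). -/
private theorem lr_clip {ω : BondConfig (Site 2)} (hω : ω ⊆ (zdGraph 2).edgeSet) {A B : ℤ} {m : ℕ}
    (h : ω ∈ embRectCrossing (fun v => zDia v - ((A : ℂ) + (B : ℂ) * I)) (2 * m) m) :
    ∃ x y : Site 2, col x = A ∧ col y = A + 2 * m ∧
      ω ∈ openConnIn {v : Site 2 | A ≤ col v ∧ col v ≤ A + 2 * m ∧ B ≤ hgtOf v ∧ hgtOf v ≤ B + m}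
        x y := by
  obtain ⟨x, hx, y, hy, hxy⟩ := h
  simp only [Set.mem_setOf_eq, sub_re, add_re, intCast_re, mul_re, I_re, mul_zero, intCast_im,
    I_im, mul_one, sub_self, add_zero, zDia_re] at hx hy
  have ix : col x ≤ A := by exact_mod_cast (by linarith : (col x : ℝ) ≤ A)
  have iy : A + 2 * (m : ℤ) ≤ col y := by
    exact_mod_cast (by linarith : (A : ℝ) + 2 * (m : ℝ) ≤ col y)
  obtain ⟨x', y', hx', hy', hconn⟩ := exists_openConnIn_clip hω col col_le_of_adj (a := A)
    (b := A + 2 * m) (by omega) ix iy hxy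
  refine ⟨x', y', hx', hy', openConnIn_mono (fun v hv => ?_) _ _ hconn⟩
  obtain ⟨⟨-, him⟩, h1, h2⟩ := hv
  simp only [sub_im, add_im, intCast_im, mul_im, I_re, mul_zero, intCast_re, I_im, mul_one,
    zero_add, add_zero, zDia_im, Set.mem_Icc] at him
  exact ⟨h1, h2, by exact_mod_cast (by linarith [him.1] : (B : ℝ) ≤ hgtOf v),
    by exact_mod_cast (by linarith [him.2] : (hgtOf v : ℝ) ≤ B + m)⟩

/-- A top–bottom crossing of the turned `m × 2m` box at `(A, B)` (the event of `diag_tb_lower`)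
contains, on a lattice configuration, an open path inside the exact box
`{A ≤ d ≤ A + m, B ≤ s ≤ B + 2m}` from `{s = B}` to `{s = B + 2m}` (`hgtOf` is `1`-Lipschitz). -/
private theorem tb_clip {ω : BondConfig (Site 2)} (hω : ω ⊆ (zdGraph 2).edgeSet) {A B : ℤ} {m : ℕ}
    (h : ω ∈ embTBCrossing (fun v => zDia v - ((A : ℂ) + (B : ℂ) * I)) m (2 * m)) :
    ∃ x y : Site 2, hgtOf x = B ∧ hgtOf y = B + 2 * m ∧
      ω ∈ openConnIn {v : Site 2 | A ≤ col v ∧ col v ≤ A + m ∧ B ≤ hgtOf v ∧ hgtOf v ≤ B + 2 * m}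
        x y := by
  obtain ⟨x, hx, y, hy, hxy⟩ := h
  simp only [Set.mem_setOf_eq, sub_im, add_im, intCast_im, mul_im, I_re, mul_zero, intCast_re,
    I_im, mul_one, zero_add, add_zero, zDia_im] at hx hy
  have ix : hgtOf x ≤ B := by exact_mod_cast (by linarith : (hgtOf x : ℝ) ≤ B)
  have iy : B + 2 * (m : ℤ) ≤ hgtOf y := by
    exact_mod_cast (by linarith : (B : ℝ) + 2 * (m : ℝ) ≤ hgtOf y)
  obtain ⟨x', y', hx', hy', hconn⟩ := exists_openConnIn_clip hω hgtOf hgtOf_le_of_adj (a := B)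
    (b := B + 2 * m) (by omega) ix iy hxy
  refine ⟨x', y', hx', hy', openConnIn_mono (fun v hv => ?_) _ _ hconn⟩
  obtain ⟨⟨hre, -⟩, h1, h2⟩ := hv
  simp only [sub_re, add_re, intCast_re, mul_re, I_re, mul_zero, intCast_im, I_im, mul_one,
    sub_self, add_zero, zDia_re, Set.mem_Icc] at hre
  exact ⟨by exact_mod_cast (by linarith [hre.1] : (A : ℝ) ≤ col v),
    by exact_mod_cast (by linarith [hre.2] : (col v : ℝ) ≤ A + m), h1, h2⟩

/-- **Gluing.** On a lattice configuration, if the diagonal half-plane arm event at scale `n ≥ 1`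
occurs together with the four turned box crossings — right pillar
`C_v[{0 ≤ d ≤ n} × {1-2n ≤ s ≤ 1}]`, left pillar `C_v[{-n ≤ d ≤ 0} × {1-2n ≤ s ≤ 1}]`, bar
`C_h[{-n ≤ d ≤ n} × {-n ≤ s ≤ 0}]`, down-crossing `C_v[{0 ≤ d ≤ n} × {-2n ≤ s ≤ 0}]` — then `0` is
joined inside the strip `{-2n ≤ s ≤ 1}` to a site of height `-2n`: the arm crosses the bar's box
vertically or a pillar's box horizontally, the pillars cross the bar, the bar crosses the
down-crossing (Grimmett 1999, §11.7). -/
private theorem arm_glue {n : ℕ} (hn : 1 ≤ n) {ω : BondConfig (Site 2)}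
    (hω : ω ⊆ (zdGraph 2).edgeSet)
    (hA : ∃ y : Site 2, (y 0 + y 1 = -(n : ℤ) ∨ y 0 - y 1 = (n : ℤ) ∨ y 0 - y 1 = -(n : ℤ)) ∧
      ω ∈ openConnIn {v : Site 2 | v 0 + v 1 ≤ 1 ∧ -(n : ℤ) ≤ v 0 + v 1 ∧
        -(n : ℤ) ≤ v 0 - v 1 ∧ v 0 - v 1 ≤ n} 0 y)
    (hR : ω ∈ embTBCrossing (fun v => zDia v - (((0 : ℤ) : ℂ) + ((1 - 2 * n : ℤ) : ℂ) * I)) n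
      (2 * n))
    (hL : ω ∈ embTBCrossing (fun v => zDia v - (((-n : ℤ) : ℂ) + ((1 - 2 * n : ℤ) : ℂ) * I)) n
      (2 * n))
    (hH : ω ∈ embRectCrossing (fun v => zDia v - (((-n : ℤ) : ℂ) + ((-n : ℤ) : ℂ) * I)) (2 * n) n)
    (hD : ω ∈ embTBCrossing (fun v => zDia v - (((0 : ℤ) : ℂ) + ((-(2 * n) : ℤ) : ℂ) * I)) n
      (2 * n)) :
    ∃ y : Site 2, hgtOf y = -(2 * n : ℤ) ∧
      ω ∈ openConnIn {v : Site 2 | -(2 * n : ℤ) ≤ hgtOf v ∧ hgtOf v ≤ 1} 0 y := by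
  obtain ⟨y, hy, hγ⟩ := hA
  obtain ⟨xR, yR, hxR, hyR, hR'⟩ := tb_clip hω hR
  obtain ⟨xL, yL, hxL, hyL, hL'⟩ := tb_clip hω hL
  obtain ⟨xH, yH, hxH, hyH, hH'⟩ := lr_clip hω hH
  obtain ⟨xD, yD, hxD, hyD, hD'⟩ := tb_clip hω hD
  have h00 : hgtOf (0 : Site 2) = 0 := by simp [hgtOf]
  have c00 : col (0 : Site 2) = 0 := by simp [col]
  have hys : hgtOf y = y 0 + y 1 := rfl
  have hyc : col y = y 0 - y 1 := rfl
  -- everything is pushed into the strip `T`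
  set T : Set (Site 2) := {v : Site 2 | -(2 * n : ℤ) ≤ hgtOf v ∧ hgtOf v ≤ 1} with hT
  have toT : ∀ {S : Set (Site 2)} {a b : Site 2}, ω ∈ openConnIn S a b →
      (∀ v ∈ S, -(2 * n : ℤ) ≤ hgtOf v ∧ hgtOf v ≤ 1) → ω ∈ openConnIn T a b :=
    fun h hS => openConnIn_mono (fun v hv => hS v hv) _ _ h
  -- the bar meets the down-crossing: `xH ↔ xD` inside `T`
  obtain ⟨u₁, h1, -, h1', -⟩ := meet hω hH' hD' (a₁ := 0) (a₂ := n) (c₁ := -n) (c₂ := 0)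
    (by omega) (by omega)
    (fun v hv => by simp only [Set.mem_setOf_eq] at hv; omega) (by omega) (by omega)
    (fun v hv => by simp only [Set.mem_setOf_eq] at hv; omega) (by omega) (by omega)
  have hHD : ω ∈ openConnIn T xH xD :=
    GM.openConnIn_trans (toT h1 fun v hv => by simp only [Set.mem_setOf_eq] at hv; omega)
      (GM.openConnIn_comm.1 (toT h1' fun v hv => by simp only [Set.mem_setOf_eq] at hv; omega))
  refine ⟨xD, hxD, ?_⟩
  suffices h0H : ω ∈ openConnIn T 0 xH from GM.openConnIn_trans h0H hHD
  have hγ' : ω ∈ openConnIn _ y 0 := GM.openConnIn_comm.1 hγ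
  rcases hy with hy | hy | hy
  · -- arm to the bottom `{s = -n}`: it crosses the bar's box vertically
    obtain ⟨u, hu1, -, -, hu4⟩ := meet hω hH' hγ' (a₁ := -n) (a₂ := n) (c₁ := -n) (c₂ := 0)
      (by omega) (by omega)
      (fun v hv => by simp only [Set.mem_setOf_eq] at hv; omega) (by omega) (by omega)
      (fun v hv => by simp only [Set.mem_setOf_eq, col] at hv ⊢; omega) (by omega) (by omega)
    exact GM.openConnIn_trans
      (GM.openConnIn_comm.1 (toT hu4 fun v hv => by
        simp only [Set.mem_setOf_eq, hgtOf] at hv ⊢; omega))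
      (GM.openConnIn_comm.1 (toT hu1 fun v hv => by simp only [Set.mem_setOf_eq] at hv; omega))
  · -- arm to the right side `{d = n}`: it crosses the right pillar's box horizontally
    obtain ⟨u, hu1, -, hu3, -⟩ := meet hω hγ hR' (a₁ := 0) (a₂ := n) (c₁ := -n) (c₂ := 1)
      (by omega) (by omega)
      (fun v hv => by simp only [Set.mem_setOf_eq, hgtOf] at hv ⊢; omega) (by omega) (by omega)
      (fun v hv => by simp only [Set.mem_setOf_eq] at hv; omega) (by omega) (by omega)
    obtain ⟨w, hw1, -, hw3, -⟩ := meet hω hH' hR' (a₁ := 0) (a₂ := n) (c₁ := -n) (c₂ := 0)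
      (by omega) (by omega)
      (fun v hv => by simp only [Set.mem_setOf_eq] at hv; omega) (by omega) (by omega)
      (fun v hv => by simp only [Set.mem_setOf_eq] at hv; omega) (by omega) (by omega)
    exact GM.openConnIn_trans (GM.openConnIn_trans (GM.openConnIn_trans
      (toT hu1 fun v hv => by simp only [Set.mem_setOf_eq, hgtOf] at hv ⊢; omega)
      (GM.openConnIn_comm.1 (toT hu3 fun v hv => by simp only [Set.mem_setOf_eq] at hv; omega)))
      (toT hw3 fun v hv => by simp only [Set.mem_setOf_eq] at hv; omega))
      (GM.openConnIn_comm.1 (toT hw1 fun v hv => by simp only [Set.mem_setOf_eq] at hv; omega))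
  · -- arm to the left side `{d = -n}`: it crosses the left pillar's box horizontally
    obtain ⟨u, -, hu2, hu3, -⟩ := meet hω hγ' hL' (a₁ := -n) (a₂ := 0) (c₁ := -n) (c₂ := 1)
      (by omega) (by omega)
      (fun v hv => by simp only [Set.mem_setOf_eq, hgtOf] at hv ⊢; omega) (by omega) (by omega)
      (fun v hv => by simp only [Set.mem_setOf_eq] at hv; omega) (by omega) (by omega)
    obtain ⟨w, hw1, -, hw3, -⟩ := meet hω hH' hL' (a₁ := -n) (a₂ := 0) (c₁ := -n) (c₂ := 0)
      (by omega) (by omega)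
      (fun v hv => by simp only [Set.mem_setOf_eq] at hv; omega) (by omega) (by omega)
      (fun v hv => by simp only [Set.mem_setOf_eq] at hv; omega) (by omega) (by omega)
    exact GM.openConnIn_trans (GM.openConnIn_trans (GM.openConnIn_trans
      (GM.openConnIn_comm.1 (toT hu2 fun v hv => by
        simp only [Set.mem_setOf_eq, hgtOf] at hv ⊢; omega))
      (GM.openConnIn_comm.1 (toT hu3 fun v hv => by simp only [Set.mem_setOf_eq] at hv; omega)))
      (toT hw3 fun v hv => by simp only [Set.mem_setOf_eq] at hv; omega))
      (GM.openConnIn_comm.1 (toT hw1 fun v hv => by simp only [Set.mem_setOf_eq] at hv; omega))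

/-- The diagonal half-plane arm event is the open crossing event of the half-diamond from `{0}` to
its outer boundary. -/
private theorem arm_eq (n : ℕ) :
    {ω : BondConfig (Site 2) | ∃ y : Site 2,
        (y 0 + y 1 = -(n : ℤ) ∨ y 0 - y 1 = (n : ℤ) ∨ y 0 - y 1 = -(n : ℤ)) ∧
        ω ∈ openConnIn {v : Site 2 | v 0 + v 1 ≤ 1 ∧ -(n : ℤ) ≤ v 0 + v 1 ∧
          -(n : ℤ) ≤ v 0 - v 1 ∧ v 0 - v 1 ≤ n} 0 y} =
      openCrossing {v : Site 2 | v 0 + v 1 ≤ 1 ∧ -(n : ℤ) ≤ v 0 + v 1 ∧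
          -(n : ℤ) ≤ v 0 - v 1 ∧ v 0 - v 1 ≤ n} {0}
        {y : Site 2 | y 0 + y 1 = -(n : ℤ) ∨ y 0 - y 1 = (n : ℤ) ∨ y 0 - y 1 = -(n : ℤ)} := by
  ext ω
  simp only [Set.mem_setOf_eq, mem_openCrossing_iff, Set.mem_singleton_iff, exists_eq_left]

/-- Translation by `(2n, 0)` of the sets `{P(s)}`: `s ↦ s + 2n`. -/
private theorem image_shift (n : ℕ) (P : ℤ → Prop) :
    (· + (![2 * (n : ℤ), 0] : Site 2)) '' {v : Site 2 | P (hgtOf v)} =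
      {v : Site 2 | P (v 0 + v 1 - 2 * n)} := by
  ext x
  simp only [Set.mem_image, Set.mem_setOf_eq, hgtOf]
  constructor
  · rintro ⟨y, hy, rfl⟩
    convert hy using 2
    simp only [Pi.add_apply, Matrix.cons_val_zero, Matrix.cons_val_one, Matrix.cons_val_fin_one]
    omega
  · intro hx
    refine ⟨x - ![2 * (n : ℤ), 0], ?_, sub_add_cancel _ _⟩
    convert hx using 2
    simp only [Pi.sub_apply, Matrix.cons_val_zero, Matrix.cons_val_one, Matrix.cons_val_fin_one]
    omega

/-- **Translation.** `P_b(2n+1)` is the probability that `0` is joined inside `{-2n ≤ s ≤ 1}` to the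
row `{s = -2n}` (translation invariance of `P_{1/2}`, `real_openCrossing_shift`). -/
private theorem passage_real_eq (n : ℕ) :
    (bondPercolation (zdGraph 2) half).real
        {ω | ∃ y : Site 2, y 0 + y 1 = 0 ∧
          ω ∈ openConnIn {v : Site 2 | 0 ≤ v 0 + v 1 ∧ v 0 + v 1 ≤ 2 * (n : ℤ) + 1}
            ![2 * (n : ℤ), 0] y} =
      (bondPercolation (zdGraph 2) half).real
        (openCrossing {v : Site 2 | -(2 * n : ℤ) ≤ hgtOf v ∧ hgtOf v ≤ 1} {0}
          {y : Site 2 | hgtOf y = -(2 * n : ℤ)}) := by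
  rw [← real_openCrossing_shift half (![2 * (n : ℤ), 0] : Site 2)
    {v : Site 2 | -(2 * n : ℤ) ≤ hgtOf v ∧ hgtOf v ≤ 1} {0} {y : Site 2 | hgtOf y = -(2 * n : ℤ)},
    image_shift n (fun t => -(2 * n : ℤ) ≤ t ∧ t ≤ 1), image_shift n (fun t => t = -(2 * n : ℤ))]
  simp only [Set.image_singleton, zero_add]
  congr 1
  ext ω
  simp only [Set.mem_setOf_eq, mem_openCrossing_iff, Set.mem_singleton_iff, exists_eq_left]
  constructor
  · rintro ⟨y, hy, h⟩
    exact ⟨y, by omega, openConnIn_mono (fun v hv => by simp only [Set.mem_setOf_eq] at hv ⊢; omega)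
      _ _ h⟩
  · rintro ⟨y, hy, h⟩
    exact ⟨y, by omega, openConnIn_mono (fun v hv => by simp only [Set.mem_setOf_eq] at hv ⊢; omega)
      _ _ h⟩

/-- **Trivial lower bound** `4⁻ⁿ ≤ P_b(2n+1)`: an open bottom row of `[0, 2n] × [0, 0]`
(`pow_le_crossingProb`) joins `(0,0)` (on the wired row) to `(2n, 0)` inside the strip. -/
private theorem pow_le_passage (n : ℕ) :
    ((1 : ℝ) / 2) ^ (2 * n) ≤ (bondPercolation (zdGraph 2) half).real
        {ω | ∃ y : Site 2, y 0 + y 1 = 0 ∧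
          ω ∈ openConnIn {v : Site 2 | 0 ≤ v 0 + v 1 ∧ v 0 + v 1 ≤ 2 * (n : ℤ) + 1}
            ![2 * (n : ℤ), 0] y} := by
  have h := pow_le_crossingProb half (2 * n) 0
  rw [coe_half] at h
  refine h.trans ?_
  unfold crossingProb lrCrossing
  refine measureReal_mono ?_
  rintro ω ⟨x, hx, y, hy, hxy⟩
  simp only [leftSide, rightSide, Finset.coe_filter, Set.mem_setOf_eq, mem_rectangle_iff] at hx hy
  have hy' : y = ![2 * (n : ℤ), 0] := by
    ext i; fin_cases i <;> simp <;> omega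
  refine ⟨x, by omega, ?_⟩
  rw [← hy']
  exact GM.openConnIn_comm.1 (openConnIn_mono (fun v hv => by
    simp only [Finset.mem_coe, mem_rectangle_iff] at hv
    simp only [Set.mem_setOf_eq]; omega) _ _ hxy)

/-- **The gluing inequality at a good scale.** If at scale `n ≥ 1` the turned `2n × n` boxes are
crossed horizontally with probability `≥ c_H` and the `n × 2n` boxes vertically with probability
`≥ c_V`, uniformly in the integer position, then `c_V³ c_H · π◇(n) ≤ P_b(2n+1)` (Harris–FKG for the
five increasing events, `arm_glue` on the almost sure lattice configurations, translation). -/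
private theorem passage_ge_of_scale {n : ℕ} (hn : 1 ≤ n) {cH cV : ℝ} (hcH : 0 ≤ cH) (hcV : 0 ≤ cV)
    (hHl : ∀ A B : ℤ, cH ≤ (bondPercolation (zdGraph 2) half).real
      (embRectCrossing (fun v => zDia v - ((A : ℂ) + (B : ℂ) * I)) (2 * n) n))
    (hVl : ∀ A B : ℤ, cV ≤ (bondPercolation (zdGraph 2) half).real
      (embTBCrossing (fun v => zDia v - ((A : ℂ) + (B : ℂ) * I)) n (2 * n))) :
    cV * cV * cH * cV * (bondPercolation (zdGraph 2) half).real
        {ω | ∃ y : Site 2, (y 0 + y 1 = -(n : ℤ) ∨ y 0 - y 1 = (n : ℤ) ∨ y 0 - y 1 = -(n : ℤ)) ∧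
          ω ∈ openConnIn {v : Site 2 | v 0 + v 1 ≤ 1 ∧ -(n : ℤ) ≤ v 0 + v 1 ∧
            -(n : ℤ) ≤ v 0 - v 1 ∧ v 0 - v 1 ≤ n} 0 y} ≤
      (bondPercolation (zdGraph 2) half).real
        {ω | ∃ y : Site 2, y 0 + y 1 = 0 ∧
          ω ∈ openConnIn {v : Site 2 | 0 ≤ v 0 + v 1 ∧ v 0 + v 1 ≤ 2 * (n : ℤ) + 1}
            ![2 * (n : ℤ), 0] y} := by
  rw [arm_eq n, passage_real_eq n]
  set μ := bondPercolation (zdGraph 2) half with hμ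
  set Arm : Set (BondConfig (Site 2)) :=
    openCrossing {v : Site 2 | v 0 + v 1 ≤ 1 ∧ -(n : ℤ) ≤ v 0 + v 1 ∧
        -(n : ℤ) ≤ v 0 - v 1 ∧ v 0 - v 1 ≤ n} {0}
      {y : Site 2 | y 0 + y 1 = -(n : ℤ) ∨ y 0 - y 1 = (n : ℤ) ∨ y 0 - y 1 = -(n : ℤ)} with hArm
  set R : Set (BondConfig (Site 2)) :=
    embTBCrossing (fun v => zDia v - (((0 : ℤ) : ℂ) + ((1 - 2 * n : ℤ) : ℂ) * I)) n (2 * n) with hR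
  set L : Set (BondConfig (Site 2)) :=
    embTBCrossing (fun v => zDia v - (((-n : ℤ) : ℂ) + ((1 - 2 * n : ℤ) : ℂ) * I)) n (2 * n) with hL
  set Hb : Set (BondConfig (Site 2)) :=
    embRectCrossing (fun v => zDia v - (((-n : ℤ) : ℂ) + ((-n : ℤ) : ℂ) * I)) (2 * n) n with hHb
  set Dn : Set (BondConfig (Site 2)) :=
    embTBCrossing (fun v => zDia v - (((0 : ℤ) : ℂ) + ((-(2 * n) : ℤ) : ℂ) * I)) n (2 * n) with hDn
  -- the five events are increasing (`U`) and measurable (`M`) open crossings: Harris–FKG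
  have U := fun S A B : Set (Site 2) => isUpperSet_openCrossing (V := Site 2) S A B
  have M := fun S A B : Set (Site 2) => IsoradialArmExtension.measurableSet_openCrossing' S A B
  have h1 : μ.real Arm * μ.real R ≤ μ.real (Arm ∩ R) :=
    harris_fkg_holds _ _ (U _ _ _) (U _ _ _) (M _ _ _) (M _ _ _)
  have h2 : μ.real (Arm ∩ R) * μ.real L ≤ μ.real (Arm ∩ R ∩ L) :=
    harris_fkg_holds _ _ ((U _ _ _).inter (U _ _ _)) (U _ _ _) ((M _ _ _).inter (M _ _ _)) (M _ _ _)
  have h3 : μ.real (Arm ∩ R ∩ L) * μ.real Hb ≤ μ.real (Arm ∩ R ∩ L ∩ Hb) :=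
    harris_fkg_holds _ _ (((U _ _ _).inter (U _ _ _)).inter (U _ _ _)) (U _ _ _)
      (((M _ _ _).inter (M _ _ _)).inter (M _ _ _)) (M _ _ _)
  have h4 : μ.real (Arm ∩ R ∩ L ∩ Hb) * μ.real Dn ≤ μ.real (Arm ∩ R ∩ L ∩ Hb ∩ Dn) :=
    harris_fkg_holds _ _ ((((U _ _ _).inter (U _ _ _)).inter (U _ _ _)).inter (U _ _ _)) (U _ _ _)
      ((((M _ _ _).inter (M _ _ _)).inter (M _ _ _)).inter (M _ _ _)) (M _ _ _)
  -- the turned-box lower bounds at the four positions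
  have bR : cV ≤ μ.real R := hVl 0 (1 - 2 * n)
  have bL : cV ≤ μ.real L := hVl (-n) (1 - 2 * n)
  have bH : cH ≤ μ.real Hb := hHl (-n) (-n)
  have bD : cV ≤ μ.real Dn := hVl 0 (-(2 * n))
  -- gluing on the almost sure lattice configurations
  have incl : μ.real (Arm ∩ R ∩ L ∩ Hb ∩ Dn) ≤
      μ.real (openCrossing {v : Site 2 | -(2 * n : ℤ) ≤ hgtOf v ∧ hgtOf v ≤ 1} {0}
        {y : Site 2 | hgtOf y = -(2 * n : ℤ)}) := by
    refine ENNReal.toReal_mono (measure_ne_top _ _) (measure_mono_ae ?_)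
    filter_upwards [ae_subset_edgeSet (zdGraph 2) half] with ω hω hX
    obtain ⟨⟨⟨⟨hA, hR'⟩, hL'⟩, hH'⟩, hD'⟩ := hX
    obtain ⟨x, hx, y, hy, hxy⟩ := hA
    rw [Set.mem_singleton_iff.1 hx] at hxy
    obtain ⟨z, hz, h⟩ := arm_glue hn hω ⟨y, hy, hxy⟩ hR' hL' hH' hD'
    exact ⟨0, rfl, z, hz, h⟩
  calc cV * cV * cH * cV * μ.real Arm = μ.real Arm * (cV * (cV * (cH * cV))) := by ring
    _ ≤ μ.real Arm * (μ.real R * (μ.real L * (μ.real Hb * μ.real Dn))) := by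
        refine mul_le_mul_of_nonneg_left ?_ measureReal_nonneg
        refine mul_le_mul bR ?_ (mul_nonneg hcV (mul_nonneg hcH hcV)) measureReal_nonneg
        refine mul_le_mul bL ?_ (mul_nonneg hcH hcV) measureReal_nonneg
        exact mul_le_mul bH bD hcV measureReal_nonneg
    _ = μ.real Arm * μ.real R * μ.real L * μ.real Hb * μ.real Dn := by ring
    _ ≤ μ.real (Arm ∩ R) * μ.real L * μ.real Hb * μ.real Dn := by gcongr
    _ ≤ μ.real (Arm ∩ R ∩ L) * μ.real Hb * μ.real Dn := by gcongr
    _ ≤ μ.real (Arm ∩ R ∩ L ∩ Hb) * μ.real Dn := by gcongr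
    _ ≤ μ.real (Arm ∩ R ∩ L ∩ Hb ∩ Dn) := h4
    _ ≤ _ := incl

/-- **S4 `stub_armLePassage`** (`= ArmLePassage` of the line skeleton): there is an absolute `c > 0`
with `c · π◇(n) ≤ P_b(2n+1)` for all `n ≥ 1`, where `π◇(n)` is the diagonal half-plane one-arm
probability (the origin joined inside `{-n ≤ v₀+v₁ ≤ 1, |v₀-v₁| ≤ n}` to
`{v₀+v₁ = -n} ∪ {v₀-v₁ = ±n}`) and `P_b(2n+1)` Ikhlef–Ponsaing's wall passage probability (`(2n,0)`
joined inside `{0 ≤ v₀+v₁ ≤ 2n+1}` to the row `{v₀+v₁ = 0}`), bond percolation on `ℤ²` at `p = 1/2`.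
`c = min (c_V³ c_H) 4^{-max m_H m_V}` with the turned-box constants of `diag_lr_lower`,
`diag_tb_lower` (`P_G = P_{1/2}` by `isoradialPercolation_square_eq_holds`): `passage_ge_of_scale`
from the larger threshold on, the open axis row (`pow_le_passage`) below it. -/
theorem stub_armLePassage :
    ∃ c : ℝ, 0 < c ∧ ∀ n : ℕ, 1 ≤ n →
      c * (bondPercolation (zdGraph 2) half).real
          {ω | ∃ y : Site 2, (y 0 + y 1 = -(n : ℤ) ∨ y 0 - y 1 = (n : ℤ) ∨ y 0 - y 1 = -(n : ℤ)) ∧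
            ω ∈ openConnIn {v : Site 2 | v 0 + v 1 ≤ 1 ∧ -(n : ℤ) ≤ v 0 + v 1 ∧
              -(n : ℤ) ≤ v 0 - v 1 ∧ v 0 - v 1 ≤ n} 0 y} ≤
      (bondPercolation (zdGraph 2) half).real
          {ω | ∃ y : Site 2, y 0 + y 1 = 0 ∧
            ω ∈ openConnIn {v : Site 2 | 0 ≤ v 0 + v 1 ∧ v 0 + v 1 ≤ 2 * (n : ℤ) + 1}
              ![2 * (n : ℤ), 0] y} := by
  obtain ⟨cH, hcH, mH, hH⟩ := diag_lr_lower
  obtain ⟨cV, hcV, mV, hV⟩ := diag_tb_lower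
  have hμ : squareLatticeEmbedding.isoradialPercolation = bondPercolation (zdGraph 2) half :=
    isoradialPercolation_square_eq_holds
  rw [hμ] at hH hV
  refine ⟨min (cV * cV * cH * cV) (((1 : ℝ) / 2) ^ (2 * max mH mV)),
    lt_min (by positivity) (by positivity), fun n hn => ?_⟩
  rcases le_or_gt (max mH mV) n with hN | hN
  · calc min (cV * cV * cH * cV) (((1 : ℝ) / 2) ^ (2 * max mH mV)) * _
        ≤ cV * cV * cH * cV * _ := mul_le_mul_of_nonneg_right (min_le_left _ _) measureReal_nonneg
      _ ≤ _ := passage_ge_of_scale hn hcH.le hcV.le (hH n (le_of_max_le_left hN))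
          (hV n (le_of_max_le_right hN))
  · calc min (cV * cV * cH * cV) (((1 : ℝ) / 2) ^ (2 * max mH mV)) * _
        ≤ ((1 : ℝ) / 2) ^ (2 * max mH mV) * 1 :=
          mul_le_mul (min_le_right _ _) measureReal_le_one measureReal_nonneg (by positivity)
      _ ≤ ((1 : ℝ) / 2) ^ (2 * n) := by
          rw [mul_one]
          exact pow_le_pow_of_le_one (by norm_num) (by norm_num) (by omega)
      _ ≤ _ := pow_le_passage n

end Summit.CriticalPhenomena.CardyFormulaZ2.Cruxes.HalfPlaneOneArmThird.IpPassageStirling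

end
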